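import Mathlib
import HarnessLib
import Summits.HubbardSuperconductivity.HubbardSuperconductivity.Theorems.KLProgrammeKLRegimeEngineTowerSplitCount

/-!
# Route `KLProgramme` — crux K3 ENGINE (stmt-HubbardSuperconductivity-20437 `KLRegimeEngineV17F2`), stub (b) v2, THE LEVELS PACKAGE (ℓ):
# the blocked-tower bookkeeping, part 8′ — re-measurement profiles with a TRACK-DEPENDENT rate `r^{(a·m − b)·jump}`
# (cell gate-hubbard-kl, seat gate-hubbard-kl-p4 g13; memos HOME/prover-p4/LEV-UNITS-NOTE.md, HOME/prover-p4/TWO-ANCHOR-FALSE.md)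

Part 1 (`…EngineTowerProfiles`, (T1) `towerMeasured_le_profile`) and part 8 (`…EngineTowerSplitCount`, `towerMeasured_le_profile_split`) re-measure a born
geometric profile `b k′ m ≤ A λ^{m−1} Q^m` with the FIXED gains `g^{(m−2)·jump}` (off the umklapp class) and `g^{(m−3)·jump}·h^{k′}` (on it) — the rates of
the one-leg-pinned track.  In the LEVELLED tracks (F known legs) of the levels package (ℓ) the per-block gain depends on the track: with the half-integer
units `e*(F) = min((F−1)/2, 2)` (BGM 2006, Lemma 2.5 (2.98), `γ^{h/4}` per further fixed sector; cell memo LEV-UNITS-NOTE) the F = 2 track gains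
`g^{(m−5/2)·jump} = (√g)^{(2m−5)·jump}` and the F = 4 track `(√g)^{(2m−3)·jump}`; integer units give `g^{(m−2−e)·jump}`-type rates.  This file states
the two profile lemmas ONCE for an arbitrary base `r ∈ (0,1)` and an arbitrary affine exponent `(a·m − b)·jump` (natural numbers, `3a ≥ b + 1` off the
class so that six legs still gain one `r` per block; `3a ≥ b′` on the class), so that every track is an instance:

* **`towerMeasured_le_profile_rate`** — `μ k m ≤ Σ_{k′≤k} c₁ c₂^m r^{(a m − b)(k+1−k′)} b k′ m` ⇒ `μ k m ≤ (c₁A/((1−r) r^b)) · λ^{m−1} · (c₂ r^a Q)^m`;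
* **`towerMeasured_le_profile_split_rate`** — with the on-class row `Σ_{k′≤k} c₃ c₂^m r^{(a m − b′)(k+1−k′)} h^{k′} b₂ k′ m` added:
  `μ k m ≤ (c₁/((1−r) r^b) + c₃/((1−h) r^{b′})) · A · λ^{m−1} · (c₂ r^a Q)^m`;
* the instance `(r, a, b, b′) = (g, 1, 2, 3)` is part 8's `towerMeasured_le_profile_split` verbatim (checked by `simpa only [one_mul, pow_one]` before filing;
  not re-landed); the half-integer tracks are `(√g, 2, 5, b′)` (F = 2) and `(√g, 2, 3, b′)` (F = 4) with the profile `(c₂ g Q)^m` unchanged and only the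
  amplitude prefactor moved (`r^{−b} = g^{−5/2}` in place of `g^{−2}`) — ∃-numerals of the package, nothing else.
Pure real analysis; nothing about the model is asserted; nothing asserts superconductivity.
References: Benfatto–Giuliani–Mastropietro 2006 §2.8 (2.83), (2.93)–(2.98) [cite: BenfattoGiulianiMastropietro2006]; Gawȩdzki–Kupiainen 1985 §3.
-/

noncomputable section

namespace Summit.HubbardSuperconductivity.HubbardSuperconductivity.Theorems.EngineV8

set_option linter.dupNamespace false -- summit = problem name (single-conjunct summit), D-0017

open Real Finset

/-- A finite geometric sum from exponent `1` in base `r`: `Σ_{k′ ≤ k} r^{k − k′ + 1} ≤ r/(1−r)` (`0 ≤ r < 1`). [folklore] -/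
theorem sum_range_pow_sub_succ_le {r : ℝ} (hr0 : 0 ≤ r) (hr1 : r < 1) (k : ℕ) :
    ∑ k' ∈ range (k + 1), r ^ (k - k' + 1) ≤ r / (1 - r) := by
  have hrefl := sum_range_reflect (fun t => r ^ (t + 1)) (k + 1)
  have : ∑ k' ∈ range (k + 1), r ^ (k - k' + 1) = ∑ t ∈ range (k + 1), r ^ (t + 1) := by
    rw [← hrefl]
    refine sum_congr rfl fun j _ => ?_
    simp only [Nat.add_sub_cancel]
  rw [this]
  exact sum_range_pow_succ_le hr0 hr1 _

/-- A finite geometric sum from exponent `0` in base `h`: `Σ_{k′ ≤ k} h^{k′} ≤ 1/(1−h)` (`0 ≤ h < 1`). [folklore] -/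
theorem sum_range_pow_le_inv_one_sub {h : ℝ} (hh0 : 0 ≤ h) (hh1 : h < 1) (k : ℕ) :
    ∑ k' ∈ range (k + 1), h ^ k' ≤ 1 / (1 - h) := by
  have := geom_sum_Ico_le_of_lt_one hh0 hh1 (m := 0) (n := k + 1)
  rwa [pow_zero, ← range_eq_Ico] at this

/-- **(T1-rate) Re-measurement of a born geometric profile at a track-dependent rate.**  If every increment born at a boundary `k′ ≤ k` obeys
`b k′ m ≤ A λ^{m−1} Q^m` (`3 ≤ m ≤ D`) and the inputs of the step `k → k+1` are bounded by the blocked re-measurement sum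
`μ k m ≤ Σ_{k′ ≤ k} c₁ c₂^m r^{(a·m − b)(k+1−k′)} b k′ m` with a base `0 < r < 1` and an exponent gaining at least one `r` per block at six legs
(`b + 1 ≤ 3a`), then `μ k m ≤ (c₁ A/((1−r) r^b)) · λ^{m−1} · (c₂ r^a Q)^m`.  Part 1's (T1) is `(r, a, b) = (g, 1, 2)`; the half-integer levelled tracks
are `(√g, 2, 5)` and `(√g, 2, 3)`. [cite: BenfattoGiulianiMastropietro2006, §2.8 (2.83), (2.93)-(2.98)] -/
theorem towerMeasured_le_profile_rate {D a b : ℕ} {bb μ : ℕ → ℕ → ℝ} {A lam Q r c₁ c₂ : ℝ}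
    (hA : 0 ≤ A) (hlam : 0 ≤ lam) (hQ : 0 ≤ Q) (hr0 : 0 < r) (hr1 : r < 1) (hc₁ : 0 ≤ c₁) (hc₂ : 0 ≤ c₂)
    (hab : b + 1 ≤ 3 * a) (hb0 : ∀ k m, 0 ≤ bb k m) {k : ℕ}
    (hμ : ∀ m, 3 ≤ m → m ≤ D → μ k m ≤ ∑ k' ∈ range (k + 1), c₁ * c₂ ^ m * r ^ ((a * m - b) * (k + 1 - k')) * bb k' m)
    (hborn : ∀ k' ≤ k, ∀ m, 3 ≤ m → m ≤ D → bb k' m ≤ A * lam ^ (m - 1) * Q ^ m)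
    {m : ℕ} (hm : 3 ≤ m) (hmD : m ≤ D) :
    μ k m ≤ c₁ * A / ((1 - r) * r ^ b) * lam ^ (m - 1) * (c₂ * r ^ a * Q) ^ m := by
  have hr1' : 0 < 1 - r := sub_pos.2 hr1
  have ham : b + 1 ≤ a * m := hab.trans (by nlinarith)
  refine (hμ m hm hmD).trans ?_
  -- each term: the born law, and `r^{(am-b)(k+1-k')} ≤ r^{am-b-1} · r^{k-k'+1}`
  have hterm : ∀ k' ∈ range (k + 1), c₁ * c₂ ^ m * r ^ ((a * m - b) * (k + 1 - k')) * bb k' m ≤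
      (c₁ * c₂ ^ m * r ^ (a * m - b - 1) * (A * lam ^ (m - 1) * Q ^ m)) * r ^ (k - k' + 1) := by
    intro k' hk'
    have hk'le : k' ≤ k := Nat.lt_succ_iff.1 (mem_range.1 hk')
    have hpow : r ^ ((a * m - b) * (k + 1 - k')) ≤ r ^ (a * m - b - 1) * r ^ (k - k' + 1) := by
      rw [← pow_add]
      refine pow_le_pow_of_le_one hr0.le hr1.le ?_
      have h1 : k + 1 - k' = k - k' + 1 := by omega
      rw [h1]
      set X := a * m - b with hX
      set Y := k - k' with hY
      have hX1 : 1 ≤ X := by omega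
      zify [hX1]
      nlinarith [Nat.zero_le (X - 1), Nat.zero_le Y]
    calc c₁ * c₂ ^ m * r ^ ((a * m - b) * (k + 1 - k')) * bb k' m
        ≤ c₁ * c₂ ^ m * (r ^ (a * m - b - 1) * r ^ (k - k' + 1)) * (A * lam ^ (m - 1) * Q ^ m) := by
          have := hborn k' hk'le m hm hmD
          have := hb0 k' m
          gcongr
      _ = _ := by ring
  refine (sum_le_sum hterm).trans ?_
  rw [← mul_sum]
  have hcoef : 0 ≤ c₁ * c₂ ^ m * r ^ (a * m - b - 1) * (A * lam ^ (m - 1) * Q ^ m) := by positivity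
  calc c₁ * c₂ ^ m * r ^ (a * m - b - 1) * (A * lam ^ (m - 1) * Q ^ m) * ∑ k' ∈ range (k + 1), r ^ (k - k' + 1)
      ≤ c₁ * c₂ ^ m * r ^ (a * m - b - 1) * (A * lam ^ (m - 1) * Q ^ m) * (r / (1 - r)) :=
        mul_le_mul_of_nonneg_left (sum_range_pow_sub_succ_le hr0.le hr1 k) hcoef
    _ = c₁ * A / ((1 - r) * r ^ b) * lam ^ (m - 1) * (c₂ * r ^ a * Q) ^ m := by
        have hram : (r ^ a) ^ m = r ^ (a * m - b - 1) * r * r ^ b := by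
          rw [← pow_mul, ← pow_succ, ← pow_add]; congr 1; omega
        rw [mul_pow, mul_pow, hram]
        field_simp

/-- **(T1-rate, split) Re-measurement with the split (correlated) count at track-dependent rates.**  Off-class row at rate `r^{(a·m − b)·jump}` on the
track's own born sizes `bb`, on-class row at rate `r^{(a·m − b′)·jump}` (possibly `r^0`) with the absolute-level weight `h^{k′}` on the all-known track's
born sizes `b₂`; both tracks under the law `A λ^{m−1} Q^m` (each in its own units); `b + 1 ≤ 3a`, `b′ ≤ 3a`.  Then
`μ k m ≤ (c₁/((1−r) r^b) + c₃/((1−h) r^{b′})) · A · λ^{m−1} · (c₂ r^a Q)^m` for `3 ≤ m ≤ D`.  Part 8's `towerMeasured_le_profile_split` is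
`(r, a, b, b′) = (g, 1, 2, 3)`. [cite: BenfattoGiulianiMastropietro2006, §2.8 (2.83), (2.93)-(2.98)] -/
theorem towerMeasured_le_profile_split_rate {D a b b' : ℕ} {bb b₂ μ : ℕ → ℕ → ℝ} {A lam Q r h c₁ c₂ c₃ : ℝ}
    (hA : 0 ≤ A) (hlam : 0 ≤ lam) (hQ : 0 ≤ Q) (hr0 : 0 < r) (hr1 : r < 1) (hh0 : 0 ≤ h) (hh1 : h < 1) (hc₁ : 0 ≤ c₁) (hc₂ : 0 ≤ c₂)
    (hc₃ : 0 ≤ c₃) (hab : b + 1 ≤ 3 * a) (hab' : b' ≤ 3 * a) (hb0 : ∀ k m, 0 ≤ bb k m) (hb₂0 : ∀ k m, 0 ≤ b₂ k m) {k : ℕ}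
    (hμ : ∀ m, 3 ≤ m → m ≤ D → μ k m ≤
      ∑ k' ∈ range (k + 1), c₁ * c₂ ^ m * r ^ ((a * m - b) * (k + 1 - k')) * bb k' m +
        ∑ k' ∈ range (k + 1), c₃ * c₂ ^ m * r ^ ((a * m - b') * (k + 1 - k')) * h ^ k' * b₂ k' m)
    (hborn : ∀ k' ≤ k, ∀ m, 3 ≤ m → m ≤ D → bb k' m ≤ A * lam ^ (m - 1) * Q ^ m)
    (hborn₂ : ∀ k' ≤ k, ∀ m, 3 ≤ m → m ≤ D → b₂ k' m ≤ A * lam ^ (m - 1) * Q ^ m)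
    {m : ℕ} (hm : 3 ≤ m) (hmD : m ≤ D) :
    μ k m ≤ (c₁ / ((1 - r) * r ^ b) + c₃ / ((1 - h) * r ^ b')) * A * lam ^ (m - 1) * (c₂ * r ^ a * Q) ^ m := by
  have hr1' : 0 < 1 - r := sub_pos.2 hr1
  have hh1' : 0 < 1 - h := sub_pos.2 hh1
  have ham' : b' ≤ a * m := hab'.trans (by nlinarith)
  -- the off-class row: the rate lemma applied to the off-class majorant itself
  set μoff : ℕ → ℕ → ℝ := fun k m => ∑ k' ∈ range (k + 1), c₁ * c₂ ^ m * r ^ ((a * m - b) * (k + 1 - k')) * bb k' m with hμoff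
  have hoff : μoff k m ≤ c₁ * A / ((1 - r) * r ^ b) * lam ^ (m - 1) * (c₂ * r ^ a * Q) ^ m :=
    towerMeasured_le_profile_rate (D := D) (μ := μoff) hA hlam hQ hr0 hr1 hc₁ hc₂ hab hb0 (fun m _ _ => le_rfl) hborn hm hmD
  -- the on-class row: `r^{(am-b')(k+1-k')} ≤ r^{am-b'}` and `Σ h^{k'} ≤ 1/(1-h)`
  have hon : ∑ k' ∈ range (k + 1), c₃ * c₂ ^ m * r ^ ((a * m - b') * (k + 1 - k')) * h ^ k' * b₂ k' m ≤
      c₃ / ((1 - h) * r ^ b') * A * lam ^ (m - 1) * (c₂ * r ^ a * Q) ^ m := by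
    have hterm : ∀ k' ∈ range (k + 1), c₃ * c₂ ^ m * r ^ ((a * m - b') * (k + 1 - k')) * h ^ k' * b₂ k' m ≤
        (c₃ * c₂ ^ m * r ^ (a * m - b') * (A * lam ^ (m - 1) * Q ^ m)) * h ^ k' := by
      intro k' hk'
      have hk'le : k' ≤ k := Nat.lt_succ_iff.1 (mem_range.1 hk')
      have hpow : r ^ ((a * m - b') * (k + 1 - k')) ≤ r ^ (a * m - b') :=
        pow_le_pow_of_le_one hr0.le hr1.le (Nat.le_mul_of_pos_right _ (by omega))
      have := hborn₂ k' hk'le m hm hmD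
      have := hb₂0 k' m
      calc c₃ * c₂ ^ m * r ^ ((a * m - b') * (k + 1 - k')) * h ^ k' * b₂ k' m
          ≤ c₃ * c₂ ^ m * r ^ (a * m - b') * h ^ k' * (A * lam ^ (m - 1) * Q ^ m) := by gcongr
        _ = _ := by ring
    refine (sum_le_sum hterm).trans ?_
    rw [← mul_sum]
    calc c₃ * c₂ ^ m * r ^ (a * m - b') * (A * lam ^ (m - 1) * Q ^ m) * ∑ k' ∈ range (k + 1), h ^ k'
        ≤ c₃ * c₂ ^ m * r ^ (a * m - b') * (A * lam ^ (m - 1) * Q ^ m) * (1 / (1 - h)) :=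
          mul_le_mul_of_nonneg_left (sum_range_pow_le_inv_one_sub hh0 hh1 k) (by positivity)
      _ = c₃ / ((1 - h) * r ^ b') * A * lam ^ (m - 1) * (c₂ * r ^ a * Q) ^ m := by
          have hram : (r ^ a) ^ m = r ^ (a * m - b') * r ^ b' := by rw [← pow_mul, ← pow_add]; congr 1; omega
          rw [mul_pow, mul_pow, hram]
          field_simp
  calc μ k m ≤ μoff k m + ∑ k' ∈ range (k + 1), c₃ * c₂ ^ m * r ^ ((a * m - b') * (k + 1 - k')) * h ^ k' * b₂ k' m := hμ m hm hmD
    _ ≤ c₁ * A / ((1 - r) * r ^ b) * lam ^ (m - 1) * (c₂ * r ^ a * Q) ^ m +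
          c₃ / ((1 - h) * r ^ b') * A * lam ^ (m - 1) * (c₂ * r ^ a * Q) ^ m := add_le_add hoff hon
    _ = _ := by ring

end Summit.HubbardSuperconductivity.HubbardSuperconductivity.Theorems.EngineV8

end
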